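import Mathlib.MeasureTheory.Integral.Bochner.Basic
import Mathlib.MeasureTheory.Integral.IntegrableOn
import Mathlib.Topology.Algebra.Order.Group
import Literature.MathematicalPhysics.QuantumLattice.LatticeGaugeDLR
import HarnessLib

/-!
# Closedness of `2`-cochains passes to weak limits

Crux `stmt-QuantumFields-8760`
(`Summit.QuantumFields.YangMills.Theses.EquipartitionCriticality.EquipartitionPinsProbe`), line
`Sketch`, stub `stub_closedLimit` (TW).

Setting: probability measures `ν_n`, `τ` on the `ℝ^D`-valued `2`-cochains
`Ω := ZdPlaquette 4 → Fin D → ℝ` of `ℤ⁴` (product topology, product σ-algebra) with `ν_n → τ`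
weakly, i.e. `∫ f dν_n → ∫ f dτ` for every bounded continuous `f : Ω → ℝ`. If the cube
coboundary `L Y := ∂ᵢ Y_{jk} − ∂ⱼ Y_{ik} + ∂ₖ Y_{ij}` (colour `a`, base point `x`, `i < j < k`,
`∂ᵢ` the forward difference along `eᵢ`) vanishes `ν_n`-a.e. for every `n`, then it vanishes
`τ`-a.e.

Proof (`TangentClosedLimit.ae_eq_zero_of_weakLimit`, for any measurable and continuous
`L : Ω → ℝ` on any measurable space carrying a topology, `τ` finite): test the weak convergence
against `g := min |L| 1`, continuous with `0 ≤ g ≤ 1`. Since `g = 0` `ν_n`-a.e.,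
`∫ g dν_n = 0` for all `n`, so `∫ g dτ = 0` (uniqueness of limits); `g` is bounded and
measurable, hence `τ`-integrable, so `g = 0` `τ`-a.e. (`integral_eq_zero_iff_of_nonneg`), i.e.
`L = 0` `τ`-a.e. (`min |t| 1 = 0 ↔ t = 0`). The six coordinate evaluations `Y ↦ Y p a` entering
`L` are measurable (`measurable_pi_apply`) and continuous (`continuous_apply`). Mathlib only.
-/

noncomputable section

open MeasureTheory Filter Topology
open Literature.MathematicalPhysics.QuantumLattice Literature.Probability.LatticeModels

namespace Summit.QuantumFields.YangMills.Theorems.EquipartitionPinsProbe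

namespace TangentClosedLimit

/-- `min |t| 1 = 0 ↔ t = 0` in `ℝ`. -/
theorem min_abs_one_eq_zero_iff (t : ℝ) : min |t| 1 = 0 ↔ t = 0 := by
  refine ⟨fun h => ?_, fun h => by rw [h, abs_zero]; exact min_eq_left zero_le_one⟩
  rcases min_choice |t| 1 with h' | h'
  · exact abs_eq_zero.1 (h'.symm.trans h)
  · exact absurd (h'.symm.trans h) one_ne_zero

/-- **A.e. vanishing of a continuous function passes to weak limits.** On a measurable space
carrying a topology, let `L` be measurable and continuous, let `∫ f dν_n → ∫ f dτ` for every
bounded continuous `f`, `τ` finite, and `L = 0` `ν_n`-a.e. for every `n`. Then `L = 0` `τ`-a.e.: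
the bounded continuous test function `min |L| 1 ≥ 0` has `ν_n`-integral `0`, hence `τ`-integral
`0`, hence vanishes `τ`-a.e. -/
theorem ae_eq_zero_of_weakLimit {Ω : Type*} [MeasurableSpace Ω] [TopologicalSpace Ω]
    {ν : ℕ → Measure Ω} {τ : Measure Ω} [IsFiniteMeasure τ]
    (hweak : ∀ f : Ω → ℝ, Continuous f → (∃ C : ℝ, ∀ Y, |f Y| ≤ C) →
      Tendsto (fun k : ℕ => ∫ Y, f Y ∂(ν k)) atTop (𝓝 (∫ Y, f Y ∂τ)))
    {L : Ω → ℝ} (hLm : Measurable L) (hLc : Continuous L) (hae : ∀ n, ∀ᵐ Y ∂(ν n), L Y = 0) :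
    ∀ᵐ Y ∂τ, L Y = 0 := by
  have hφ : Continuous fun t : ℝ => min |t| 1 := continuous_abs.min continuous_const
  have hgc : Continuous fun Y => min |L Y| 1 := hφ.comp hLc
  have hgm : Measurable fun Y => min |L Y| 1 := hφ.measurable.comp hLm
  have hg0 : ∀ Y, 0 ≤ min |L Y| 1 := fun Y => le_min (abs_nonneg _) zero_le_one
  have hg1 : ∀ Y, |min |L Y| 1| ≤ 1 := fun Y => by
    rw [abs_of_nonneg (hg0 Y)]
    exact min_le_right _ _
  have hn : ∀ n, ∫ Y, min |L Y| 1 ∂(ν n) = 0 := fun n =>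
    integral_eq_zero_of_ae ((hae n).mono fun Y hY => by simp [hY])
  have hτ0 : ∫ Y, min |L Y| 1 ∂τ = 0 := by
    have h := hweak _ hgc ⟨1, hg1⟩
    simp only [hn] at h
    exact tendsto_nhds_unique h tendsto_const_nhds
  have hint : Integrable (fun Y => min |L Y| 1) τ :=
    Integrable.of_bound hgm.aestronglyMeasurable 1
      (ae_of_all _ fun Y => by rw [Real.norm_eq_abs]; exact hg1 Y)
  have h0 : (fun Y => min |L Y| 1) =ᵐ[τ] 0 :=
    (integral_eq_zero_iff_of_nonneg (fun Y => hg0 Y) hint).1 hτ0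
  exact h0.mono fun Y hY => by
    have hY' : min |L Y| 1 = 0 := hY
    exact (min_abs_one_eq_zero_iff _).1 hY'

/-- Coordinate evaluation `Y ↦ Y p a` on `α → β → ℝ` is measurable for the product σ-algebra. -/
theorem measurable_eval₂ {α β : Type*} (p : α) (a : β) :
    Measurable fun Y : α → β → ℝ => Y p a :=
  (measurable_pi_apply a).comp (measurable_pi_apply p)

/-- Coordinate evaluation `Y ↦ Y p a` on `α → β → ℝ` is continuous for the product topology. -/
theorem continuous_eval₂ {α β : Type*} (p : α) (a : β) :
    Continuous fun Y : α → β → ℝ => Y p a :=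
  (continuous_apply a).comp (continuous_apply p)

end TangentClosedLimit

/-- STUB `stub_closedLimit` (TW) — **closedness survives weak limits**: if probability measures
`ν_n` on the `ℝ^D`-valued `2`-cochains of `ℤ⁴` converge weakly (against bounded continuous
functions) to `τ`, and every `ν_n` is carried by cochains whose cube coboundary
`∂ᵢ Y_{jk} − ∂ⱼ Y_{ik} + ∂ₖ Y_{ij}` vanishes at the `3`-cell `(x; i < j < k)` in colour `a`, then
so is `τ` (test the weak convergence against `min (|∂ᵢ Y_{jk} − ∂ⱼ Y_{ik} + ∂ₖ Y_{ij}|) 1`,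
`TangentClosedLimit.ae_eq_zero_of_weakLimit`). -/
theorem stub_closedLimit :
    ∀ (D : ℕ) (ν : ℕ → MeasureTheory.Measure (Literature.MathematicalPhysics.QuantumLattice.ZdPlaquette 4 → Fin D → ℝ))
      (τ : MeasureTheory.Measure (Literature.MathematicalPhysics.QuantumLattice.ZdPlaquette 4 → Fin D → ℝ)),
      (∀ k, MeasureTheory.IsProbabilityMeasure (ν k)) → MeasureTheory.IsProbabilityMeasure τ →
      (∀ f : (Literature.MathematicalPhysics.QuantumLattice.ZdPlaquette 4 → Fin D → ℝ) → ℝ, Continuous f → (∃ C : ℝ, ∀ Y, |f Y| ≤ C) →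
          Filter.Tendsto (fun k : ℕ => ∫ Y, f Y ∂(ν k)) Filter.atTop (nhds (∫ Y, f Y ∂τ))) →
      ∀ (x : Literature.Probability.LatticeModels.Site 4) (i j k : Fin 4) (hij : i < j) (hjk : j < k) (a : Fin D),
        (∀ n : ℕ, ∀ᵐ Y ∂(ν n),
          (Y (x + Pi.single i 1, ⟨(j, k), hjk⟩) a - Y (x, ⟨(j, k), hjk⟩) a) -
            (Y (x + Pi.single j 1, ⟨(i, k), hij.trans hjk⟩) a - Y (x, ⟨(i, k), hij.trans hjk⟩) a) +
            (Y (x + Pi.single k 1, ⟨(i, j), hij⟩) a - Y (x, ⟨(i, j), hij⟩) a) = 0) →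
        ∀ᵐ Y ∂τ,
          (Y (x + Pi.single i 1, ⟨(j, k), hjk⟩) a - Y (x, ⟨(j, k), hjk⟩) a) -
            (Y (x + Pi.single j 1, ⟨(i, k), hij.trans hjk⟩) a - Y (x, ⟨(i, k), hij.trans hjk⟩) a) +
            (Y (x + Pi.single k 1, ⟨(i, j), hij⟩) a - Y (x, ⟨(i, j), hij⟩) a) = 0 := by
  intro D ν τ _ hτ hweak x i j k hij hjk a hae
  haveI : IsProbabilityMeasure τ := hτ
  refine TangentClosedLimit.ae_eq_zero_of_weakLimit hweak ?_ ?_ hae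
  · exact (((TangentClosedLimit.measurable_eval₂ _ _).sub
        (TangentClosedLimit.measurable_eval₂ _ _)).sub
      ((TangentClosedLimit.measurable_eval₂ _ _).sub
        (TangentClosedLimit.measurable_eval₂ _ _))).add
      ((TangentClosedLimit.measurable_eval₂ _ _).sub (TangentClosedLimit.measurable_eval₂ _ _))
  · exact (((TangentClosedLimit.continuous_eval₂ _ _).sub
        (TangentClosedLimit.continuous_eval₂ _ _)).sub
      ((TangentClosedLimit.continuous_eval₂ _ _).sub
        (TangentClosedLimit.continuous_eval₂ _ _))).add
      ((TangentClosedLimit.continuous_eval₂ _ _).sub (TangentClosedLimit.continuous_eval₂ _ _))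

end Summit.QuantumFields.YangMills.Theorems.EquipartitionPinsProbe

end
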